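import Literature.AnabelianGeometry.EtaleTheta.TemperedFrobenioidToy
import HarnessLib

/-!
# [EtTh] Def 3.6 (ii)(b): the bracketed sentence is NOT a consequence of the typed interface —
# two more inhabitants of the Def 3.3 (iii) / 3.6 (i) / 3.6 (ii) stack (kernel independence certificates)

S. Mochizuki, *The étale theta function …*, Publ. RIMS **45** (2009) [MochizukiEtTh2009], Def 3.6 (ii)(b),
printed p.303 (PDF p.77) l.8–10: "(b) … for every `A ∈ Ob(D)`, the homomorphism `F(A) → (Φ^{bs-fld})^gp(A)`
is nonzero]. [Thus, it follows from these conditions that for every `A ∈ Ob(D)`, the image of the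
homomorphism `F(A) → (Φ^{bs-fld})^gp(A)` contains a nonzero element of `Φ^{bs-fld}(A)`.]"

abc-iut cell, layer L2, seat abc-iut-w4-d008 (gen 3); cell GAP-LEDGER row G-w5d124-2.  The typed interface
`TemperedFrobenioid` (abc-iut-L2-t3) records condition (b) as the field `exists_FΛ_div_ne` (a constant with
divisor `x/y`, `x ≠ y ∈ Φ(A)`); the bracketed CONSEQUENCE is carried by abc-iut-w5-d124's row C38-L05
(`bsFldPreStepLimitCriterion_of`, `Discharge/Sec3Cor38Criterion.lean`) as the binder `hNZ`.  This file is the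
kernel form of w5-d124's remark that `hNZ` does not follow over the typed structure, in the style of
`SettingModelIndependence.lean` (what a MODEL decides):

* `ToyHNZ` — the stack over the one-object base with `Φ₀ = Φ₀^ℝ = Φ = ℕ³ = ⟨P, Q, R⟩`,
  `ℝ·Φ₀^cnst = {(a, b, c) ∈ ℤ³ | a + b = 0} ∋ P−Q, R`, `B₀ = B₀^Λ = F₀ = F₀^Λ = ℤ·b₀` with `div(b₀) = P − Q`, over the
  trivial [FrdI] vocabularies of `TemperedFrobenioidToy.lean`.  EVERY typed field holds — in particular the REAL
  ones: `Φ^{bs-fld} = ℕ·R ≅ ℕ` is monoprime (`IsMonoprime`, [FrdI] §0), (b) holds with the constant `b₀`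
  (divisor `P/Q`, `P ≠ Q`), `ℝ·Φ₀^cnst` is root-closed, `Φ` is group-saturated — and moreover
  `DivisorMonoids.Prop34` and the C38-L05 binder `hP34Λ` hold (all functions are constant); but `hNZ` FAILS:
  a constant `k·b₀` has divisor `k(P−Q)`, effective only for `k = 0` (`ToyHNZ.not_hNZ`).  Hence
  `ToyHNZ.hNZ_not_derivable`: `hNZ` is not a consequence of the typed Def 3.6 (ii) fields + Prop 3.4 + `hP34Λ`.
  What the model violates is print's "`ℝ·Φ₀^cnst = ℝ·div(ϖ)` is a LINE of (anti-)effective divisors"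
  (Prop 3.4 (ii)); `P − Q` is neither.
* `ToyHNZ₂` — the stack with `Φ₀ = Φ₀^ℝ = Φ = ℕ = ⟨𝔭⟩`, `ℝ·Φ₀^cnst =` everything (a LINE: every element of `ℕ^gp = ℤ`
  is `±`effective; `ℕ` integral), `B₀^Λ = ℤ·b₀ ⊋ F₀^Λ = ℕ·b₀`, `div(b₀) = 𝔭⁻¹`: every typed field holds, the line
  and integrality properties hold, yet `hNZ` FAILS (constants have anti-effective divisors) — and so does
  `hP34Λ` (`b₀⁻¹` has effective divisor but is not in `F₀^Λ`).  So the third input of the derivation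
  `Discharge/Sec3Def36NonzeroConstants.lean` (`hP34Λ`, or inverse-closure of `F₀^Λ`) cannot be dropped.

READING: nothing here is a statement about tempered Frobenioids of curves; it says which printed properties of
the Def 3.6 (i) data the typed record leaves free (a v-next field «ℝ·Φ₀^cnst(Y) is totally ordered by
effectivity» + «Φ₀^ℝ integral», or the binder list of `…NonzeroConstants`), numbers-not-opinions for the planners.
Def-bearing WITNESS file (models); no Prop facts, no instances, no notation; consumed by no [IUTchIII] Cor 3.12
artefact; no side taken there.
-/

noncomputable section

namespace Literature.AnabelianGeometry.EtaleTheta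

open CategoryTheory Opposite Literature.AlgebraicGeometry.Frobenioids

/-- `gpMap id = id`, pointwise (transition maps of constant functors). [folklore] -/
private theorem gpMap_id_apply {N : Type} [CommMonoid N] (x : Algebra.GrothendieckGroup N) :
    gpMap (MonoidHom.id N) x = x :=
  DFunLike.congr_fun (Literature.AlgebraicGeometry.Frobenioids.gpMap_id (M := N)) x

/-- `lift f (of m) = f m` for the Grothendieck group. [folklore] -/
private theorem lift_of {N : Type} [CommMonoid N] {G : Type} [CommGroup G] (f : N →* G) (m : N) :
    Algebra.GrothendieckGroup.lift f (Algebra.GrothendieckGroup.of m) = f m := by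
  have h := Algebra.GrothendieckGroup.lift.symm_apply_apply f
  rw [Algebra.GrothendieckGroup.lift_symm_apply] at h
  exact DFunLike.congr_fun h m

/-! ## Model 1: `Φ = ℕ³`, the constant "line" `{a + b = 0}` is not a line of (anti-)effective divisors -/

namespace ToyHNZ

/-- `Φ₀ = Φ₀^ℝ = Φ := ℕ³`, the free commutative monoid on `P = (1,0,0)`, `Q = (0,1,0)`, `R = (0,0,1)`.
[cite: MochizukiEtTh2009, Def 3.3 p.73] -/
abbrev Div3 : Type := Multiplicative (ℕ × ℕ × ℕ)

/-- The prime `P`. [cite: MochizukiEtTh2009, Def 3.3 p.73] -/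
def P : Div3 := Multiplicative.ofAdd (1, 0, 0)

/-- The prime `Q`. [cite: MochizukiEtTh2009, Def 3.3 p.73] -/
def Q : Div3 := Multiplicative.ofAdd (0, 1, 0)

/-- `P ≠ Q`. [cite: MochizukiEtTh2009, Def 3.6 p.77] -/
theorem P_ne_Q : P ≠ Q := by
  intro h
  have := congrArg (fun m : Div3 => (Multiplicative.toAdd m).1) h
  simp [P, Q] at this

/-- A coordinate `ℕ³ → ℤ` (through `π : ℕ³ → ℕ`), multiplicatively. [folklore] -/
def coord (π : ℕ × ℕ × ℕ →+ ℕ) : Div3 →* Multiplicative ℤ :=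
  AddMonoidHom.toMultiplicative ((Nat.castAddMonoidHom ℤ).comp π)

/-- Its extension to `(ℕ³)^gp`. [folklore] -/
def liftC (π : ℕ × ℕ × ℕ →+ ℕ) : Algebra.GrothendieckGroup Div3 →* Multiplicative ℤ :=
  Algebra.GrothendieckGroup.lift (coord π)

/-- `liftC π (of m) = π(m)`. [folklore] -/
private theorem liftC_of (π : ℕ × ℕ × ℕ →+ ℕ) (m : Div3) :
    liftC π (Algebra.GrothendieckGroup.of m) = Multiplicative.ofAdd ((π (Multiplicative.toAdd m) : ℕ) : ℤ) :=
  lift_of _ _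

/-- The `P`-coordinate. [folklore] -/
abbrev πP : ℕ × ℕ × ℕ →+ ℕ := AddMonoidHom.fst ℕ (ℕ × ℕ)

/-- The `Q`-coordinate. [folklore] -/
abbrev πQ : ℕ × ℕ × ℕ →+ ℕ := (AddMonoidHom.fst ℕ ℕ).comp (AddMonoidHom.snd ℕ (ℕ × ℕ))

/-- The `R`-coordinate. [folklore] -/
abbrev πR : ℕ × ℕ × ℕ →+ ℕ := (AddMonoidHom.snd ℕ ℕ).comp (AddMonoidHom.snd ℕ (ℕ × ℕ))

/-- `ℝ·Φ₀^cnst := {g ∈ (ℕ³)^gp | (P-coordinate) + (Q-coordinate) = 0}` — a root-closed subgroup containing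
`P − Q` and `R`. [cite: MochizukiEtTh2009, Def 3.6 p.76] -/
def cnstK : Subgroup (Algebra.GrothendieckGroup Div3) := (liftC πP * liftC πQ).ker

/-- Membership of an effective element in `ℝ·Φ₀^cnst`: `a + b = 0`. [cite: MochizukiEtTh2009, Def 3.6 p.76] -/
theorem of_mem_cnstK_iff (m : Div3) :
    Algebra.GrothendieckGroup.of m ∈ cnstK ↔ (Multiplicative.toAdd m).1 = 0 ∧ (Multiplicative.toAdd m).2.1 = 0 := by
  rw [cnstK, MonoidHom.mem_ker, MonoidHom.mul_apply, liftC_of, liftC_of, ← ofAdd_add, ofAdd_eq_one]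
  simp only [AddMonoidHom.coe_fst, AddMonoidHom.coe_comp, AddMonoidHom.coe_snd, Function.comp_apply]
  omega

/-- The divisor `P − Q = div(b₀)` of the generating constant. [cite: MochizukiEtTh2009, Def 3.3 p.73] -/
def divPQ : Algebra.GrothendieckGroup Div3 := Algebra.GrothendieckGroup.of P / Algebra.GrothendieckGroup.of Q

/-- Coordinates of `(P − Q)^k`: `liftC π ((P−Q)^k) = k·(π(P) − π(Q))`. [folklore] -/
private theorem liftC_divPQ_zpow (π : ℕ × ℕ × ℕ →+ ℕ) (k : ℤ) :
    liftC π (divPQ ^ k) = Multiplicative.ofAdd (k * (((π (1, 0, 0) : ℕ) : ℤ) - ((π (0, 1, 0) : ℕ) : ℤ))) := by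
  rw [map_zpow, divPQ, map_div, liftC_of, liftC_of, ← ofAdd_sub, ← ofAdd_zsmul, zsmul_eq_mul]
  rfl

/-- `P − Q ∈ ℝ·Φ₀^cnst`. [cite: MochizukiEtTh2009, Def 3.6 p.76] -/
theorem divPQ_mem_cnstK : divPQ ∈ cnstK := by
  rw [cnstK, MonoidHom.mem_ker, MonoidHom.mul_apply, ← zpow_one divPQ, liftC_divPQ_zpow, liftC_divPQ_zpow,
    ← ofAdd_add, ofAdd_eq_one]
  simp

/-- `ℝ·Φ₀^cnst` is root-closed (a kernel into the torsion-free `ℤ`). [cite: MochizukiEtTh2009, Def 3.6 p.76] -/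
theorem cnstK_root (g : Algebra.GrothendieckGroup Div3) (n : ℕ+) (hg : g ^ (n : ℕ) ∈ cnstK) : g ∈ cnstK := by
  rw [cnstK, MonoidHom.mem_ker] at hg ⊢
  rw [map_pow] at hg
  have h := congrArg Multiplicative.toAdd hg
  rw [toAdd_pow, toAdd_one, nsmul_eq_mul, mul_eq_zero] at h
  rcases h with h | h
  · exact absurd (by exact_mod_cast h) n.ne_zero
  · exact Multiplicative.toAdd.injective (by rw [h, toAdd_one])

/-- **The key computation**: a power `(P − Q)^k` is effective only trivially — if `(P−Q)^k = of(m)` with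
`m ∈ ℕ³` then `m = 0` (coordinates: `k = a`, `−k = b`, `0 = c` with `a, b, c ≥ 0`).
[cite: MochizukiEtTh2009, Def 3.6 p.77] -/
theorem eq_one_of_divPQ_zpow_eq_of (k : ℤ) (m : Div3) (h : divPQ ^ k = Algebra.GrothendieckGroup.of m) :
    m = 1 := by
  have hP := congrArg (liftC πP) h
  have hQ := congrArg (liftC πQ) h
  have hR := congrArg (liftC πR) h
  rw [liftC_divPQ_zpow, liftC_of] at hP hQ hR
  replace hP := Multiplicative.ofAdd.injective hP
  replace hQ := Multiplicative.ofAdd.injective hQ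
  replace hR := Multiplicative.ofAdd.injective hR
  simp only [AddMonoidHom.coe_fst, AddMonoidHom.coe_comp, AddMonoidHom.coe_snd, Function.comp_apply,
    Nat.cast_one, Nat.cast_zero, sub_zero, zero_sub, mul_one, mul_neg, mul_zero] at hP hQ hR
  apply Multiplicative.toAdd.injective
  rw [toAdd_one]
  refine Prod.ext ?_ (Prod.ext ?_ ?_) <;> simp only [Prod.fst_zero, Prod.snd_zero] <;> omega

/-- **Def 3.3 (iii) data of model 1**: `Φ₀ = ℕ³`, `B₀ = ℤ·b₀` with `div(b₀) = P − Q`, all functions constant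
(`F₀ = B₀`), everything non-cuspidal; one-object base. [cite: MochizukiEtTh2009, Def 3.3 p.73] -/
def divisorMonoids : DivisorMonoids.{0, 0, 0} (Discrete PUnit.{1}) where
  Φ₀ := (Functor.const _).obj (CommMonCat.of Div3)
  B₀ := (Functor.const _).obj (CommMonCat.of (Multiplicative ℤ))
  isUnit_B₀ _ b := by
    change IsUnit (M := Multiplicative ℤ) b
    exact Group.isUnit _
  div₀ _ := zpowersHom _ divPQ
  div₀_natural _ b := (gpMap_id_apply (zpowersHom _ divPQ b)).symm
  F₀ _ := ⊤
  F₀_map _ _ _ := trivial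
  ncsp₀ _ := ⊤
  csp₀ _ := ⊥
  ncsp₀_map _ _ _ := trivial
  csp₀_map _ x hx := by
    rw [Submonoid.mem_bot] at hx ⊢
    rw [hx, map_one]
  existsUnique_ncsp_csp _ x := by
    refine ⟨(⟨x, trivial⟩, ⟨1, Submonoid.mem_bot.mpr rfl⟩), mul_one x, ?_⟩
    rintro ⟨a, c⟩ h
    have hc : c.1 = 1 := Submonoid.mem_bot.mp c.2
    have ha : a.1 = x := by
      have h' : a.1 * c.1 = x := h
      rwa [hc, mul_one] at h'
    exact Prod.ext (Subtype.ext ha) (Subtype.ext hc)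

/-- **Def 3.6 (i) data of model 1** (`Λ = ℤ`, `Φ₀^ℝ = Φ₀`, `B₀^Λ = B₀`, `F₀^Λ = F₀ = B₀`,
`ℝ·Φ₀^cnst = {a + b = 0}`), over the trivial vocabulary. [cite: MochizukiEtTh2009, Def 3.6 p.76] -/
def realified : RealifiedDivisorMonoids (D₀ := Discrete PUnit.{1}) Toy.monoidVocab where
  toDivisorMonoids := divisorMonoids
  Λ := MonoidType.Z
  ΦR := (Functor.const _).obj (CommMonCat.of Div3)
  toR _ := MonoidHom.id _
  toR_natural _ _ := rfl
  isRealification _ := trivial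
  BΛ := (Functor.const _).obj (CommMonCat.of (Multiplicative ℤ))
  isUnit_BΛ _ b := by
    change IsUnit (M := Multiplicative ℤ) b
    exact Group.isUnit _
  divΛ _ := zpowersHom _ divPQ
  divΛ_natural _ b := (gpMap_id_apply (zpowersHom _ divPQ b)).symm
  FΛ _ := ⊤
  FΛ_map _ _ _ := trivial
  cnstR _ := cnstK
  cnstR_map _ x hx := (congrArg (· ∈ cnstK) (gpMap_id_apply x)).mpr hx
  divΛ_mem_cnstR _ b _ := cnstK.zpow_mem divPQ_mem_cnstK (Multiplicative.toAdd b)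
  cnstR_root _ g n hg := cnstK_root g n hg
  cnst_le_cnstR _ b _ :=
    (congrArg (· ∈ cnstK) (gpMap_id_apply _)).mpr (cnstK.zpow_mem divPQ_mem_cnstK (Multiplicative.toAdd b))
  ncspR _ := ⊤
  cspR _ := ⊥
  toR_ncsp _ _ _ := trivial
  toR_csp _ _ hx := hx

/-- The base-field-theoretic submonoid of model 1: `Φ ∩ ℝ·Φ₀^cnst = {(0, 0, c)} = ℕ·R`.
[cite: MochizukiEtTh2009, Def 3.6 p.77] -/
theorem mem_bsFld_iff (m : Div3) :
    m ∈ ((⊤ : Submonoid Div3) ⊓ cnstK.toSubmonoid.comap Algebra.GrothendieckGroup.of) ↔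
      (Multiplicative.toAdd m).1 = 0 ∧ (Multiplicative.toAdd m).2.1 = 0 := by
  rw [Submonoid.mem_inf, Submonoid.mem_comap, Subgroup.mem_toSubmonoid, of_mem_cnstK_iff]
  exact and_iff_right (Submonoid.mem_top m)

/-- `Φ^{bs-fld} = ℕ·R ≅ ℕ` (the `R`-coordinate). [cite: MochizukiEtTh2009, Def 3.6 p.77] -/
def bsFldEquiv : ↥((⊤ : Submonoid Div3) ⊓ cnstK.toSubmonoid.comap Algebra.GrothendieckGroup.of) ≃*
    Multiplicative ℕ where
  toFun s := Multiplicative.ofAdd (Multiplicative.toAdd s.1).2.2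
  invFun c := ⟨Multiplicative.ofAdd (0, 0, Multiplicative.toAdd c), (mem_bsFld_iff _).2 ⟨rfl, rfl⟩⟩
  left_inv s := by
    obtain ⟨h1, h2⟩ := (mem_bsFld_iff s.1).1 s.2
    apply Subtype.ext
    apply Multiplicative.toAdd.injective
    exact Prod.ext h1.symm (Prod.ext h2.symm rfl)
  right_inv c := rfl
  map_mul' s t := by
    rw [← ofAdd_add]
    rfl

/-- `Φ^{bs-fld}` of model 1 is (`ℤ`-)monoprime — the REAL [FrdI] §0 notion. [cite: MochizukiEtTh2009, Def 3.6 p.77] -/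
theorem isMonoprime_bsFld :
    IsMonoprime ↥((⊤ : Submonoid Div3) ⊓ cnstK.toSubmonoid.comap Algebra.GrothendieckGroup.of) :=
  IsMonoprime.ofZ ⟨⟨bsFldEquiv⟩⟩

/-- **Def 3.6 (ii), model 1**: the tempered-Frobenioid interface over `realified` with `D = D₀` the one-object
category and `Φ = Φ^{ℝ-log} = ℕ³`: group-saturated (trivially), `Φ^{bs-fld} = ℕ·R` monoprime (REAL), and (b):
the constant `b₀` has divisor `P/Q` with `P ≠ Q` (REAL). [cite: MochizukiEtTh2009, Def 3.6 p.77] -/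
def temperedFrobenioid : TemperedFrobenioid realified (Discrete PUnit.{1}) Toy.catVocab where
  isConnected := zigzag_isConnected fun j₁ j₂ => by rw [Subsingleton.elim j₁ j₂]
  isTotallyEpimorphic := ⟨fun f => ⟨fun _ _ _ => Subsingleton.elim _ _⟩⟩
  base := 𝟭 _
  Φ := ⟨fun _ => ⊤, fun _ _ _ => trivial⟩
  isGroupSaturated A := (isGroupSaturated_iff' _).2 fun _ _ _ _ _ _ => trivial
  isPerfFactorial _ := trivial
  isDivisorialOn := trivial
  isMonoprime_bsFld _ := isMonoprime_bsFld
  exists_FΛ_div_ne _ := ⟨(Multiplicative.ofAdd (1 : ℤ) : Multiplicative ℤ), trivial, P, trivial, Q, trivial,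
    P_ne_Q, by
      change divPQ ^ Multiplicative.toAdd (Multiplicative.ofAdd (1 : ℤ)) = _
      rw [toAdd_ofAdd, zpow_one]
      rfl⟩

/-- **Model 1 violates `hNZ`** (the bracketed sentence of Def 3.6 (ii)(b) as typed in row C38-L05): every
constant is `k·b₀` with divisor `(P−Q)^k`, which is effective only for `k = 0`.
[cite: MochizukiEtTh2009, Def 3.6 p.77] -/
theorem not_hNZ : ¬ ∀ A : (Discrete PUnit.{1})ᵒᵖ,
    ∃ u : (realified.BΛ.obj (temperedFrobenioid.baseOp A) : Type) ×
        Algebra.GrothendieckGroup (temperedFrobenioid.Φ.carrier A),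
      u ∈ temperedFrobenioid.cnstFn A ∧
        ∃ Z : temperedFrobenioid.Φ.carrier A, Z ≠ 1 ∧ u.2 = Algebra.GrothendieckGroup.of Z := by
  intro h
  obtain ⟨u, hu, Z, hZ1, hZ⟩ := h (op ⟨PUnit.unit⟩)
  obtain ⟨b, ξ⟩ := u
  obtain ⟨m, hm⟩ := Z
  have hZ' : ξ = Algebra.GrothendieckGroup.of ⟨m, hm⟩ := hZ
  subst hZ'
  have h1 : realified.divΛ _ b = temperedFrobenioid.ΦgpToRlog _ (Algebra.GrothendieckGroup.of ⟨m, hm⟩) :=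
    (Submonoid.mem_inf.1 hu).1
  rw [TemperedFrobenioid.ΦgpToRlog, gpMap_of] at h1
  have h2 : divPQ ^ Multiplicative.toAdd (show Multiplicative ℤ from b) =
      Algebra.GrothendieckGroup.of (show Div3 from m) := h1
  exact hZ1 (Subtype.ext (eq_one_of_divPQ_zpow_eq_of _ _ h2))

/-- Proposition 3.4 holds for model 1 (vocabulary clauses trivial; every function is constant).
[cite: MochizukiEtTh2009, Prop 3.4 p.74] -/
theorem prop34 : realified.Prop34 Toy.monoidVocab Toy.catVocab where
  isPerfFactorial _ := trivial
  isNonDilating _ _ := trivial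
  isDivisorialOn := trivial
  ker_div₀_le_F₀ _ _ _ := trivial
  mem_F₀_of_div₀_mem _ _ _ _ := trivial

/-- The C38-L05 binder `hP34Λ` (Prop 3.4 (ii) at monoid type `Λ`: effective divisor ⇒ constant) holds for model 1
(`F₀^Λ = B₀^Λ`). [cite: MochizukiEtTh2009, Prop 3.4 p.74] -/
theorem hP34Λ : ∀ (Y : (Discrete PUnit.{1})ᵒᵖ) (b : realified.BΛ.obj Y) (r : realified.ΦR.obj Y),
    realified.divΛ Y b = Algebra.GrothendieckGroup.of r → b ∈ realified.FΛ Y :=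
  fun _ _ _ _ => trivial

/-- **Independence certificate (G-w5d124-2)**: over the typed Def 3.3 (iii)/3.6 (i)/3.6 (ii) interface — even
together with Proposition 3.4 (`DivisorMonoids.Prop34`) and the C38-L05 binder `hP34Λ` — the bracketed sentence
of Def 3.6 (ii)(b) (`hNZ`) is NOT derivable: model 1 satisfies the former and violates the latter.  (Stated over
the one-object base and the trivial vocabularies; any universally quantified derivation specialises to this
instance.) [cite: MochizukiEtTh2009, Def 3.6 p.77] -/
theorem hNZ_not_derivable : ¬ ∀ (T : RealifiedDivisorMonoids (D₀ := Discrete PUnit.{1}) Toy.monoidVocab)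
    (C : TemperedFrobenioid T (Discrete PUnit.{1}) Toy.catVocab),
    T.Prop34 Toy.monoidVocab Toy.catVocab →
    (∀ (Y : (Discrete PUnit.{1})ᵒᵖ) (b : T.BΛ.obj Y) (r : T.ΦR.obj Y),
      T.divΛ Y b = Algebra.GrothendieckGroup.of r → b ∈ T.FΛ Y) →
    ∀ A : (Discrete PUnit.{1})ᵒᵖ,
      ∃ u : (T.BΛ.obj (C.baseOp A) : Type) × Algebra.GrothendieckGroup (C.Φ.carrier A),
        u ∈ C.cnstFn A ∧ ∃ Z : C.Φ.carrier A, Z ≠ 1 ∧ u.2 = Algebra.GrothendieckGroup.of Z :=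
  fun h => not_hNZ (h realified temperedFrobenioid prop34 hP34Λ)

/-- `P − Q ≠ 0` in `(ℕ³)^gp` (its `P`-coordinate is `1`). [cite: MochizukiEtTh2009, Def 3.3 p.73] -/
theorem divPQ_ne_one : divPQ ≠ 1 := by
  intro h
  have h1 := liftC_divPQ_zpow πP 1
  rw [h, one_zpow, map_one] at h1
  have h2 := congrArg Multiplicative.toAdd h1
  simp at h2

/-- What model 1 violates among print's unrecorded properties: `ℝ·Φ₀^cnst` is NOT a line of (anti-)effective
elements — `P − Q ∈ ℝ·Φ₀^cnst` is neither `of(r)` nor `of(r)⁻¹` (print: `ℝ·Φ₀^cnst = ℝ·div(ϖ_L)`, Prop 3.4 (ii)).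
[cite: MochizukiEtTh2009, Prop 3.4 p.74] -/
theorem not_line : ¬ ∀ g : Algebra.GrothendieckGroup Div3, g ∈ cnstK →
    ∃ r : Div3, g = Algebra.GrothendieckGroup.of r ∨ g = (Algebra.GrothendieckGroup.of r)⁻¹ := by
  intro h
  obtain ⟨r, hr | hr⟩ := h divPQ divPQ_mem_cnstK
  · have h1 := eq_one_of_divPQ_zpow_eq_of 1 r (by rw [zpow_one, hr])
    rw [h1, map_one] at hr
    exact divPQ_ne_one hr
  · have h1 := eq_one_of_divPQ_zpow_eq_of (-1) r (by rw [zpow_neg, zpow_one, hr, inv_inv])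
    rw [h1, map_one, inv_one] at hr
    exact divPQ_ne_one hr

end ToyHNZ

/-! ## Model 2: `Φ = ℕ`, a genuine LINE, integral — but `F₀^Λ = ℕ·b₀` with `div(b₀) = 𝔭⁻¹` -/

namespace ToyHNZ₂

/-- The prime `𝔭 = 1 ∈ ℕ = Φ₀`. [cite: MochizukiEtTh2009, Def 3.3 p.73] -/
def 𝔭 : Multiplicative ℕ := Multiplicative.ofAdd 1

/-- `1 ≠ 𝔭`. [cite: MochizukiEtTh2009, Def 3.6 p.77] -/
theorem one_ne_𝔭 : (1 : Multiplicative ℕ) ≠ 𝔭 := by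
  intro h
  have := congrArg Multiplicative.toAdd h
  simp [𝔭] at this

/-- The degree `ℕ^gp → ℤ`. [folklore] -/
def deg : Algebra.GrothendieckGroup (Multiplicative ℕ) →* Multiplicative ℤ :=
  Algebra.GrothendieckGroup.lift (AddMonoidHom.toMultiplicative (Nat.castAddMonoidHom ℤ))

/-- `deg (of m) = m`. [folklore] -/
private theorem deg_of (m : Multiplicative ℕ) :
    deg (Algebra.GrothendieckGroup.of m) = Multiplicative.ofAdd ((Multiplicative.toAdd m : ℕ) : ℤ) :=
  lift_of _ _

/-- `div(b₀) := 𝔭⁻¹`, an ANTI-effective divisor. [cite: MochizukiEtTh2009, Def 3.6 p.76] -/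
def dinv : Algebra.GrothendieckGroup (Multiplicative ℕ) := (Algebra.GrothendieckGroup.of 𝔭)⁻¹

/-- `deg ((𝔭⁻¹)^k) = −k`. [folklore] -/
private theorem deg_dinv_zpow (k : ℤ) : deg (dinv ^ k) = Multiplicative.ofAdd (-k) := by
  rw [map_zpow, dinv, map_inv, deg_of, ← ofAdd_neg, ← ofAdd_zsmul, zsmul_eq_mul]
  simp [𝔭]

/-- `F₀^Λ := ℕ·b₀ ⊆ ℤ·b₀ = B₀^Λ` (the non-negative multiples: a submonoid that is NOT inverse-closed).
[cite: MochizukiEtTh2009, Def 3.6 p.76] -/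
def nonnegZ : Submonoid (Multiplicative ℤ) where
  carrier := {b | 0 ≤ Multiplicative.toAdd b}
  one_mem' := by
    change (0 : ℤ) ≤ Multiplicative.toAdd (1 : Multiplicative ℤ)
    rw [toAdd_one]
  mul_mem' {a b} ha hb := by
    change (0 : ℤ) ≤ Multiplicative.toAdd (a * b)
    rw [toAdd_mul]
    exact add_nonneg ha hb

/-- **Def 3.6 (i) data of model 2** over the Def 3.3 (iii) data of `TemperedFrobenioidToy` (`Φ₀ = ℕ`, `B₀ = ℤ`):
`Λ = ℤ`, `Φ₀^ℝ = Φ₀`, `B₀^Λ = ℤ·b₀`, `div(b₀) = 𝔭⁻¹`, `F₀^Λ = ℕ·b₀`, `ℝ·Φ₀^cnst =` everything.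
[cite: MochizukiEtTh2009, Def 3.6 p.76] -/
def realified : RealifiedDivisorMonoids (D₀ := Discrete PUnit.{1}) Toy.monoidVocab where
  toDivisorMonoids := Toy.divisorMonoids
  Λ := MonoidType.Z
  ΦR := (Functor.const _).obj (CommMonCat.of (Multiplicative ℕ))
  toR _ := MonoidHom.id _
  toR_natural _ _ := rfl
  isRealification _ := trivial
  BΛ := (Functor.const _).obj (CommMonCat.of (Multiplicative ℤ))
  isUnit_BΛ _ b := by
    change IsUnit (M := Multiplicative ℤ) b
    exact Group.isUnit _
  divΛ _ := zpowersHom _ dinv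
  divΛ_natural _ b := (gpMap_id_apply (zpowersHom _ dinv b)).symm
  FΛ _ := nonnegZ
  FΛ_map _ _ hb := hb
  cnstR _ := ⊤
  cnstR_map _ _ _ := trivial
  divΛ_mem_cnstR _ _ _ := trivial
  cnstR_root _ _ _ _ := trivial
  cnst_le_cnstR _ _ _ := trivial
  ncspR _ := ⊤
  cspR _ := ⊥
  toR_ncsp _ _ _ := trivial
  toR_csp _ _ hx := hx

/-- **Def 3.6 (ii), model 2**: `Φ = Φ^{ℝ-log} = ℕ`, `Φ^{bs-fld} = ℕ` monoprime, (b) with the constant `b₀`: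
`div(b₀) = 1/𝔭`, `1 ≠ 𝔭`. [cite: MochizukiEtTh2009, Def 3.6 p.77] -/
def temperedFrobenioid : TemperedFrobenioid realified (Discrete PUnit.{1}) Toy.catVocab where
  isConnected := zigzag_isConnected fun j₁ j₂ => by rw [Subsingleton.elim j₁ j₂]
  isTotallyEpimorphic := ⟨fun f => ⟨fun _ _ _ => Subsingleton.elim _ _⟩⟩
  base := 𝟭 _
  Φ := ⟨fun _ => ⊤, fun _ _ _ => trivial⟩
  isGroupSaturated A := (isGroupSaturated_iff' _).2 fun _ _ _ _ _ _ => trivial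
  isPerfFactorial _ := trivial
  isDivisorialOn := trivial
  isMonoprime_bsFld A := Toy.isMonoprime_of_eq_top
    (eq_top_iff.2 fun x _ => Submonoid.mem_inf.2 ⟨Submonoid.mem_top x,
      (Subgroup.mem_top (Algebra.GrothendieckGroup.of x) :
        Algebra.GrothendieckGroup.of x ∈ (⊤ : Subgroup (Algebra.GrothendieckGroup (Multiplicative ℕ))))⟩)
  exists_FΛ_div_ne _ := ⟨(Multiplicative.ofAdd (1 : ℤ) : Multiplicative ℤ),
    (show (0 : ℤ) ≤ Multiplicative.toAdd (Multiplicative.ofAdd (1 : ℤ)) by rw [toAdd_ofAdd]; exact zero_le_one),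
    1, trivial, 𝔭, trivial, one_ne_𝔭, by
      change dinv ^ Multiplicative.toAdd (Multiplicative.ofAdd (1 : ℤ)) = _
      rw [toAdd_ofAdd, zpow_one, map_one, one_div]
      rfl⟩

/-- **Model 2 violates `hNZ`**: constants `k·b₀`, `k ≥ 0`, have the anti-effective divisors `𝔭^{-k}`.
[cite: MochizukiEtTh2009, Def 3.6 p.77] -/
theorem not_hNZ : ¬ ∀ A : (Discrete PUnit.{1})ᵒᵖ,
    ∃ u : (realified.BΛ.obj (temperedFrobenioid.baseOp A) : Type) ×
        Algebra.GrothendieckGroup (temperedFrobenioid.Φ.carrier A),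
      u ∈ temperedFrobenioid.cnstFn A ∧
        ∃ Z : temperedFrobenioid.Φ.carrier A, Z ≠ 1 ∧ u.2 = Algebra.GrothendieckGroup.of Z := by
  intro h
  obtain ⟨u, hu, Z, hZ1, hZ⟩ := h (op ⟨PUnit.unit⟩)
  obtain ⟨b, ξ⟩ := u
  obtain ⟨m, hm⟩ := Z
  have hZ' : ξ = Algebra.GrothendieckGroup.of ⟨m, hm⟩ := hZ
  subst hZ'
  have h1 : realified.divΛ _ b = temperedFrobenioid.ΦgpToRlog _ (Algebra.GrothendieckGroup.of ⟨m, hm⟩) :=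
    (Submonoid.mem_inf.1 hu).1
  have hb : (0 : ℤ) ≤ Multiplicative.toAdd (show Multiplicative ℤ from b) := (Submonoid.mem_inf.1 hu).2
  rw [TemperedFrobenioid.ΦgpToRlog, gpMap_of] at h1
  have h2 : dinv ^ Multiplicative.toAdd (show Multiplicative ℤ from b) =
      Algebra.GrothendieckGroup.of (show Multiplicative ℕ from m) := h1
  have h3 := congrArg deg h2
  rw [deg_dinv_zpow, deg_of] at h3
  have h4 := Multiplicative.ofAdd.injective h3
  have h5 : Multiplicative.toAdd (show Multiplicative ℕ from m) = 0 := by omega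
  have h6 : (show Multiplicative ℕ from m) = 1 := Multiplicative.toAdd.injective (by rw [h5, toAdd_one])
  exact hZ1 (Subtype.ext h6)

/-- Model 2's `ℝ·Φ₀^cnst = ℕ^gp = ℤ` IS a line of (anti-)effective elements. [cite: MochizukiEtTh2009, Prop 3.4 p.74] -/
theorem line (g : Algebra.GrothendieckGroup (Multiplicative ℕ)) :
    ∃ r : Multiplicative ℕ, g = Algebra.GrothendieckGroup.of r ∨ g = (Algebra.GrothendieckGroup.of r)⁻¹ := by
  obtain ⟨⟨a, s⟩, hs⟩ := (Localization.monoidOf (⊤ : Submonoid (Multiplicative ℕ))).surj g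
  have hs' : g * Algebra.GrothendieckGroup.of (s : Multiplicative ℕ) = Algebra.GrothendieckGroup.of a := hs
  rcases le_total (Multiplicative.toAdd (s : Multiplicative ℕ)) (Multiplicative.toAdd a) with hle | hle
  · refine ⟨Multiplicative.ofAdd (Multiplicative.toAdd a - Multiplicative.toAdd (s : Multiplicative ℕ)),
      Or.inl (mul_right_cancel (hs'.trans ?_))⟩
    rw [← map_mul]
    congr 1
    apply Multiplicative.toAdd.injective
    rw [toAdd_mul, toAdd_ofAdd, Nat.sub_add_cancel hle]
  · refine ⟨Multiplicative.ofAdd (Multiplicative.toAdd (s : Multiplicative ℕ) - Multiplicative.toAdd a),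
      Or.inr (mul_right_cancel (hs'.trans ?_))⟩
    rw [eq_comm, inv_mul_eq_iff_eq_mul, ← map_mul]
    congr 1
    apply Multiplicative.toAdd.injective
    rw [toAdd_mul, toAdd_ofAdd, Nat.sub_add_cancel hle]

/-- Model 2's `Φ₀^ℝ = ℕ` is integral. [cite: MochizukiFrdI2008, Def. 2.4 (i) p.48] -/
theorem integral : ∀ Y : (Discrete PUnit.{1})ᵒᵖ, IsCancelMul (realified.ΦR.obj Y) := fun _ => by
  change IsCancelMul (Multiplicative ℕ)
  infer_instance

/-- … and `hP34Λ` FAILS for model 2: `b₀⁻¹` has the effective divisor `𝔭` but is not in `F₀^Λ = ℕ·b₀`.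
[cite: MochizukiEtTh2009, Prop 3.4 p.74] -/
theorem not_hP34Λ : ¬ ∀ (Y : (Discrete PUnit.{1})ᵒᵖ) (b : realified.BΛ.obj Y) (r : realified.ΦR.obj Y),
    realified.divΛ Y b = Algebra.GrothendieckGroup.of r → b ∈ realified.FΛ Y := by
  intro h
  have hmem := h (op ⟨PUnit.unit⟩) (Multiplicative.ofAdd (-1 : ℤ)) 𝔭 (by
    change dinv ^ Multiplicative.toAdd (Multiplicative.ofAdd (-1 : ℤ)) = _
    rw [toAdd_ofAdd, zpow_neg, zpow_one, dinv, inv_inv]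
    rfl)
  have h1 : (0 : ℤ) ≤ Multiplicative.toAdd (Multiplicative.ofAdd (-1 : ℤ)) := hmem
  rw [toAdd_ofAdd] at h1
  omega

/-- **Second certificate**: the LINE and INTEGRALITY properties of the Def 3.6 (i) data (the two inputs named
in row G-w5d124-2's proposed fix) do NOT suffice for `hNZ` over the typed interface — model 2 has both and
violates `hNZ` (and `hP34Λ`); the derivation `TemperedFrobenioid.exists_cnstFn_effective_of_line`
(`Discharge/Sec3Def36NonzeroConstants.lean`) genuinely needs its third input (`hP34Λ`, or inverse-closure of
`F₀^Λ`). [cite: MochizukiEtTh2009, Def 3.6 p.77] -/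
theorem line_and_integral_not_sufficient :
    ∃ (T : RealifiedDivisorMonoids (D₀ := Discrete PUnit.{1}) Toy.monoidVocab)
      (C : TemperedFrobenioid T (Discrete PUnit.{1}) Toy.catVocab),
      (∀ (Y : (Discrete PUnit.{1})ᵒᵖ) (g : Algebra.GrothendieckGroup (T.ΦR.obj Y)), g ∈ T.cnstR Y →
        ∃ r : T.ΦR.obj Y, g = Algebra.GrothendieckGroup.of r ∨ g = (Algebra.GrothendieckGroup.of r)⁻¹) ∧
      (∀ Y : (Discrete PUnit.{1})ᵒᵖ, IsCancelMul (T.ΦR.obj Y)) ∧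
      ¬ ∀ A : (Discrete PUnit.{1})ᵒᵖ,
        ∃ u : (T.BΛ.obj (C.baseOp A) : Type) × Algebra.GrothendieckGroup (C.Φ.carrier A),
          u ∈ C.cnstFn A ∧ ∃ Z : C.Φ.carrier A, Z ≠ 1 ∧ u.2 = Algebra.GrothendieckGroup.of Z :=
  ⟨realified, temperedFrobenioid, fun _ g _ => line g, integral, not_hNZ⟩

end ToyHNZ₂

end Literature.AnabelianGeometry.EtaleTheta
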